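import Literature.Analysis.FluidPDE.TwoHalfSection
import Literature.Analysis.FluidPDE.TwoHalfSpectralSplit
import Literature.Analysis.FluidPDE.PassiveScalarForcedClass
import Literature.Analysis.FluidPDE.NSHopfGalerkin

/-!
# Route TwoAndHalfD (AnomalousDissipation) — the vertical part of a `2½`-dimensional weak
# Navier–Stokes solution is a weak sourced passive scalar (support of item `ScalarLift2halfDR`,
# stmt-AnomalousDissipation-14983)

Helper file (everything proved). `isWeakScalarTransportForcedOn_of_twoHalf`: if
`u(t) = (V(t), Θ(t))∘π` is a forced weak (pressure-free) Navier–Stokes solution on `T³ × [0, T)`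
(`Literature.Analysis.FluidPDE.Torus.IsWeakNSSolutionForcedOn`) with steady force `(g, h)∘π`,
datum `(a, b)∘π` and `L^∞_t L²_x` slices, then `Θ` is a weak solution of the sourced passive
scalar equation `∂ₜΘ + V·∇Θ = νΔΘ + h` on `T² × [0, T)` with datum `b`
(`Literature.Analysis.FluidPDE.Torus.IsWeakScalarTransportForcedOn`): test the three-dimensional
weak formulation with the divergence-free vertical fields `(0, φ)∘π` (`isSpaceTimeTest_twoHalf_zero`,
`timeDeriv_twoHalf_zero`), identify the integrand pointwise with the planar lift of
`Θ(∂ₜφ + V·∇φ + νΔφ) + hφ`, descend the inner integrals along the measure-preserving planar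
projection, and split source from transport by product integrability (the integrability clauses
of the scalar class follow from the `L^∞_t L²_x` bound). This is the descent counterpart of the
tree's lift `Torus.weakIdentity_twoHalf` (`TwoHalfWeakEuler`).

References: Majda–Bertozzi 2002, §2.3.1; Bruè–De Lellis 2023, §3.1; DiPerna–Lions 1989, §II.1.
-/

noncomputable section

open MeasureTheory Set Filter Topology Function UnitAddTorus
open scoped ENNReal NNReal InnerProductSpace
open Literature.Analysis.FunctionSpaces Literature.Analysis.FunctionSpaces.Torus
open Literature.Analysis.FluidPDE Literature.Analysis.FluidPDE.Torus

namespace Summit.AnomalousDissipation.AnomalousDissipation.Theorems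

-- D-0017: single-problem summit ⇒ `Summit.AnomalousDissipation.AnomalousDissipation.…` by design.
set_option linter.dupNamespace false

/-! ## H3: the vertical part of a `2½`-dimensional weak Navier–Stokes solution is a weak
sourced scalar -/

section ScalarDescent

/-- Vertical test fields `(0, φ t)∘π` built from a scalar space–time test function on `T²` are
divergence-free space–time test fields on `T³`. [folklore] -/
theorem isSpaceTimeTest_twoHalf_zero {T : ℝ} {φ : ℝ → UnitAddTorus (Fin 2) → ℝ} (hφ : IsSpaceTimeTest T φ) :
    IsSpaceTimeTest T (fun t => twoHalf 0 (φ t)) ∧ IsDivFreeTest (fun t => twoHalf (0 : UnitAddTorus (Fin 2) → EuclideanSpace ℝ (Fin 2)) (φ t)) := by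
  obtain ⟨hs, T', hT', h0⟩ := hφ
  refine ⟨⟨?_, T', hT', fun t ht => ?_⟩, fun t => ?_⟩
  · have h : stLift (fun t => twoHalf (0 : UnitAddTorus (Fin 2) → EuclideanSpace ℝ (Fin 2)) (φ t)) =
        (fun r : ℝ => planarEmbed ((0 : EuclideanSpace ℝ (Fin 2)), r)) ∘ (stLift φ ∘ fun p : ℝ × EuclideanSpace ℝ (Fin 3) => (p.1, planarProjE p.2)) := by
      funext p
      simp only [stLift, Function.comp_apply, twoHalf, Pi.zero_apply, planarProj_proj]
    rw [h]
    refine (planarEmbed.contDiff.comp (contDiff_const.prodMk contDiff_id)).comp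
      (hs.comp (contDiff_fst.prodMk (planarProjE.contDiff.comp contDiff_snd)))
  · show twoHalf 0 (φ t) = 0
    rw [h0 t ht]
    exact twoHalf_zero
  · exact ((isGalerkinMode_zero 0).isDivFree).twoHalf _

/-- `L²` membership from an `L²`-type lintegral bound. [folklore] -/
theorem memLp_two_of_lintegral_enorm_sq_le {α : Type*} [MeasurableSpace α] {μ : Measure α}
    {E : Type*} [NormedAddCommGroup E] {f : α → E} (hf : AEStronglyMeasurable f μ) {C : ℝ≥0}
    (h : ∫⁻ x, ‖f x‖ₑ ^ 2 ∂μ ≤ C) : MemLp f 2 μ := by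
  refine ⟨hf, ?_⟩
  rw [eLpNorm_lt_top_iff_lintegral_rpow_enorm_lt_top two_ne_zero ENNReal.ofNat_ne_top]
  simp only [ENNReal.toReal_ofNat, ENNReal.rpow_ofNat]
  exact h.trans_lt ENNReal.coe_lt_top

/-- The convective derivative of the zero field vanishes. [folklore] -/
theorem convect_zero_field {d : Type*} [Fintype d] (a : UnitAddTorus d → EuclideanSpace ℝ d) (x : UnitAddTorus d) :
    Torus.convect a (0 : UnitAddTorus d → EuclideanSpace ℝ d) x = 0 := by
  rw [Torus.convect]
  unfold Torus.fderiv
  rw [show Torus.liftAt (0 : UnitAddTorus d → EuclideanSpace ℝ d) x = fun _ => 0 from rfl]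
  simp

/-- The Laplacian of the zero planar field vanishes. [folklore] -/
theorem laplacian_zero_field₂ (y : UnitAddTorus (Fin 2)) :
    Torus.laplacian (0 : UnitAddTorus (Fin 2) → EuclideanSpace ℝ (Fin 2)) y = 0 := by
  unfold Torus.laplacian Torus.liftAt
  simp

/-- **Time derivative of a vertical test field**: `∂ₜ (0, φ)∘π = (0, ∂ₜφ)∘π` for a smooth
space–time scalar `φ`. [folklore] -/
theorem timeDeriv_twoHalf_zero {φ : ℝ → UnitAddTorus (Fin 2) → ℝ} (hφ : ContDiff ℝ (⊤ : ℕ∞) (stLift φ)) (t : ℝ)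
    (x : UnitAddTorus (Fin 3)) :
    Torus.timeDeriv (fun t => twoHalf 0 (φ t)) t x = twoHalf 0 (Torus.timeDeriv φ t) x := by
  obtain ⟨Y, hY⟩ := proj_surjective (planarProj x)
  have hd : Differentiable ℝ (fun τ : ℝ => stLift φ (τ, Y)) :=
    (hφ.differentiable (by simp)).comp (differentiable_id.prodMk (differentiable_const Y))
  have hd' : ∀ τ, HasDerivAt (fun τ : ℝ => φ τ (planarProj x)) (deriv (fun τ : ℝ => φ τ (planarProj x)) τ) τ := by
    intro τ
    have h1 : (fun τ : ℝ => φ τ (planarProj x)) = fun τ : ℝ => stLift φ (τ, Y) := by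
      funext τ; simp [stLift, hY]
    rw [h1]
    exact (hd τ).hasDerivAt
  have h2 : HasDerivAt (fun τ : ℝ => twoHalf 0 (φ τ) x)
      (planarEmbed ((0 : EuclideanSpace ℝ (Fin 2)), deriv (fun τ : ℝ => φ τ (planarProj x)) t)) t := by
    have h3 := ((hasDerivAt_const t (0 : EuclideanSpace ℝ (Fin 2))).prodMk (hd' t))
    have h4 := planarEmbed.hasFDerivAt.comp_hasDerivAt t h3
    exact h4
  rw [Torus.timeDeriv, h2.deriv]
  rfl

/-- **The vertical part of a `2½`-dimensional forced weak Navier–Stokes solution on `T³` with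
`L^∞_t L²_x` slices is a weak sourced passive scalar on `T²`**, advected by the planar part: for
`u(t) = (V(t), Θ(t))∘π` solving the weak formulation with force `(g, h)∘π` and datum `(a, b)∘π`,
`Θ` is a weak solution of `∂ₜΘ + V·∇Θ = νΔΘ + h` with datum `b` (test the three-dimensional
identity with the divergence-free vertical fields `(0, φ)∘π`; the integrands descend to `T²` by
Fubini along the measure-preserving planar projection; the integrability clauses follow from the
`L^∞_t L²_x` bound). [folklore] -/
theorem isWeakScalarTransportForcedOn_of_twoHalf {T ν : ℝ} {g : UnitAddTorus (Fin 2) → EuclideanSpace ℝ (Fin 2)}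
    {h : UnitAddTorus (Fin 2) → ℝ} {a : UnitAddTorus (Fin 2) → EuclideanSpace ℝ (Fin 2)} {b : UnitAddTorus (Fin 2) → ℝ}
    {V : ℝ → UnitAddTorus (Fin 2) → EuclideanSpace ℝ (Fin 2)} {Θ : ℝ → UnitAddTorus (Fin 2) → ℝ}
    (hw : IsWeakNSSolutionForcedOn T ν (fun _ => twoHalf g h) (twoHalf a b) (fun t => twoHalf (V t) (Θ t)))
    (hE : ∃ C : ℝ≥0, ∀ᵐ t ∂(volume.restrict (Ioo 0 T)), ∫⁻ x, ‖twoHalf (V t) (Θ t) x‖ₑ ^ 2 ≤ C)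
    (hh : IsSmooth h) (hb : MemLp b 2 volume) :
    IsWeakScalarTransportForcedOn T ν V (fun _ => h) b Θ := by
  obtain ⟨hm3, -, hdiv3, hweak3⟩ := hw
  obtain ⟨C, hC⟩ := hE
  -- `a b ≤ a² + b²` in `ℝ≥0∞`
  have hmulsq : ∀ p q : ℝ≥0∞, p * q ≤ p ^ 2 + q ^ 2 := by
    intro p q
    rcases le_total p q with hpq | hpq
    · calc p * q ≤ q * q := mul_le_mul' hpq le_rfl
        _ = q ^ 2 := (sq q).symm
        _ ≤ p ^ 2 + q ^ 2 := le_add_self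
    · calc p * q ≤ p * p := mul_le_mul' le_rfl hpq
        _ = p ^ 2 := (sq p).symm
        _ ≤ p ^ 2 + q ^ 2 := le_self_add
  -- ### measurability of the sections
  obtain ⟨hmV, hmΘ⟩ := aestronglyMeasurable_stLift_of_twoHalf hm3
  have hmVu : AEStronglyMeasurable (uncurry V) (((volume : Measure ℝ).restrict (Ioo 0 T)).prod volume) := by
    rw [← volume_restrict_prod_eq]; exact aestronglyMeasurable_uncurry_of_stLift_restrict hmV
  have hmΘu : AEStronglyMeasurable (uncurry Θ) (((volume : Measure ℝ).restrict (Ioo 0 T)).prod volume) := by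
    rw [← volume_restrict_prod_eq]; exact aestronglyMeasurable_uncurry_of_stLift_restrict hmΘ
  have hms : AEStronglyMeasurable (stLift fun _ : ℝ => h) (volume.restrict (Ioo 0 T ×ˢ (univ : Set (EuclideanSpace ℝ (Fin 2))))) :=
    (hh.continuous.comp (continuous_proj.comp continuous_snd)).aestronglyMeasurable
  -- ### slice bounds
  have hΘb : ∀ᵐ t ∂(volume.restrict (Ioo 0 T)), ∫⁻ y, ‖Θ t y‖ₑ ^ 2 ≤ C := by
    filter_upwards [hC] with t ht
    exact (lintegral_enorm_sq_right_le_twoHalf (V t) (Θ t)).trans ht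
  have hVb : ∀ᵐ t ∂(volume.restrict (Ioo 0 T)), ∫⁻ y, ‖V t y‖ₑ ^ 2 ≤ C := by
    filter_upwards [hC] with t ht
    exact (lintegral_enorm_sq_left_le_twoHalf (V t) (Θ t)).trans ht
  have hVm_ae : ∀ᵐ t ∂(volume.restrict (Ioo 0 T)), AEStronglyMeasurable (V t) volume := hmVu.prodMk_left
  have hΘm_ae : ∀ᵐ t ∂(volume.restrict (Ioo 0 T)), AEStronglyMeasurable (Θ t) volume := hmΘu.prodMk_left
  have hVL2 : ∀ᵐ t ∂(volume.restrict (Ioo 0 T)), MemLp (V t) 2 volume := by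
    filter_upwards [hVm_ae, hVb] with t hm ht
    exact memLp_two_of_lintegral_enorm_sq_le hm ht
  have hΘL2 : ∀ᵐ t ∂(volume.restrict (Ioo 0 T)), MemLp (Θ t) 2 volume := by
    filter_upwards [hΘm_ae, hΘb] with t hm ht
    exact memLp_two_of_lintegral_enorm_sq_le hm ht
  have hvol : volume (Ioo (0 : ℝ) T) < ⊤ := measure_Ioo_lt_top
  -- ### the product `‖V‖ |Θ|`
  have hmul : ∫⁻ t in Ioo 0 T, ∫⁻ y, ‖V t y‖ₑ * ‖Θ t y‖ₑ < ⊤ := by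
    calc ∫⁻ t in Ioo 0 T, ∫⁻ y, ‖V t y‖ₑ * ‖Θ t y‖ₑ ≤ ∫⁻ _ in Ioo 0 T, ((C : ℝ≥0∞) + C) := by
          refine lintegral_mono_ae ?_
          filter_upwards [hVb, hΘb, hVm_ae] with t hV hΘ hm
          calc ∫⁻ y, ‖V t y‖ₑ * ‖Θ t y‖ₑ ≤ ∫⁻ y, (‖V t y‖ₑ ^ 2 + ‖Θ t y‖ₑ ^ 2) :=
                lintegral_mono fun y => hmulsq _ _
            _ = (∫⁻ y, ‖V t y‖ₑ ^ 2) + ∫⁻ y, ‖Θ t y‖ₑ ^ 2 := lintegral_add_left' (hm.enorm.pow_const 2) _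
            _ ≤ C + C := add_le_add hV hΘ
      _ < ⊤ := by
          rw [setLIntegral_const]
          exact ENNReal.mul_lt_top (ENNReal.add_lt_top.2 ⟨ENNReal.coe_lt_top, ENNReal.coe_lt_top⟩) hvol
  -- ### the source
  have hsrc : ∫⁻ _ in Ioo 0 T, ∫⁻ y, ‖h y‖ₑ < ⊤ := by
    rw [setLIntegral_const]
    exact ENNReal.mul_lt_top (hasFiniteIntegral_iff_enorm.1 hh.integrable.hasFiniteIntegral) hvol
  refine
    { aestronglyMeasurable := hmΘ
      aestronglyMeasurable_velocity := hmV
      aestronglyMeasurable_source := hms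
      ae_lintegral_sq_le := ⟨C, hΘb⟩
      lintegral_velocity_lt_top := ?_
      lintegral_mul_lt_top := hmul
      lintegral_source_lt_top := hsrc
      ae_isWeaklyDivFree := ?_
      weak_eq := fun φ hφ => ?_ }
  · calc ∫⁻ t in Ioo 0 T, (∫⁻ y, ‖V t y‖ₑ ^ 2) ^ (1 / 2 : ℝ) ≤ ∫⁻ _ in Ioo 0 T, (C : ℝ≥0∞) ^ (1 / 2 : ℝ) := by
          refine lintegral_mono_ae ?_
          filter_upwards [hVb] with t ht
          exact ENNReal.rpow_le_rpow ht (by norm_num)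
      _ < ⊤ := by
          rw [setLIntegral_const]
          exact ENNReal.mul_lt_top (ENNReal.rpow_lt_top_of_nonneg (by norm_num) ENNReal.coe_ne_top) hvol
  · filter_upwards [hdiv3, hVL2] with t ht hV
    exact isWeaklyDivFree_of_twoHalf hV ht
  · -- ### the weak identity: test the three-dimensional one with `(0, φ)∘π`
    obtain ⟨hΨ, hΨdiv⟩ := isSpaceTimeTest_twoHalf_zero hφ
    have key := hweak3 (fun t => twoHalf 0 (φ t)) hΨ hΨdiv
    -- pointwise identification of the integrand
    set A : ℝ → UnitAddTorus (Fin 2) → ℝ := fun t y => Θ t y *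
      (Torus.timeDeriv φ t y + ⟪V t y, Torus.gradient (φ t) y⟫_ℝ + ν * Torus.laplacian (φ t) y) with hA
    set B : ℝ → UnitAddTorus (Fin 2) → ℝ := fun t y => h y * φ t y with hB
    have hpt : ∀ t x, ⟪twoHalf (V t) (Θ t) x, Torus.timeDeriv (fun t => twoHalf 0 (φ t)) t x⟫_ℝ +
        ⟪twoHalf (V t) (Θ t) x, Torus.convect (twoHalf (V t) (Θ t)) (twoHalf 0 (φ t)) x⟫_ℝ +
        ν * ⟪twoHalf (V t) (Θ t) x, Torus.laplacian (twoHalf 0 (φ t)) x⟫_ℝ + ⟪twoHalf g h x, twoHalf 0 (φ t) x⟫_ℝ =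
        A t (planarProj x) + B t (planarProj x) := by
      intro t x
      have hφs : IsSmooth (φ t) := hφ.isSmooth_slice t
      have h0s : IsSmooth (0 : UnitAddTorus (Fin 2) → EuclideanSpace ℝ (Fin 2)) := isSmooth_const (0 : EuclideanSpace ℝ (Fin 2))
      have h01 : IsContDiff 1 (0 : UnitAddTorus (Fin 2) → EuclideanSpace ℝ (Fin 2)) := h0s.isContDiff (by simp)
      rw [timeDeriv_twoHalf_zero hφ.1 t x, inner_twoHalf, inner_twoHalf_convect (V t) (Θ t) h01 (hφs.isContDiff (by simp)),
        laplacian_twoHalf h0s hφs, inner_twoHalf, inner_twoHalf]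
      have h0 : Torus.laplacian (0 : UnitAddTorus (Fin 2) → EuclideanSpace ℝ (Fin 2)) = 0 := funext laplacian_zero_field₂
      simp only [Pi.zero_apply, inner_zero_right, zero_add, hA, hB]
      rw [h0, convect_zero_field, ← Torus.inner_gradient_left]
      simp only [Pi.zero_apply, inner_zero_right, zero_add]
      rw [real_inner_comm (V t (planarProj x)) (Torus.gradient (φ t) (planarProj x))]
      ring
    have hpt0 : ∀ x, ⟪twoHalf a b x, twoHalf 0 (φ 0) x⟫_ℝ = (fun y => b y * φ 0 y) (planarProj x) := by
      intro x
      rw [inner_twoHalf]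
      simp
    -- ### integrability on `(0,T) × T²`
    have hΘ1 : Integrable (uncurry Θ) (((volume : Measure ℝ).restrict (Ioo 0 T)).prod volume) := by
      refine ⟨hmΘu, ?_⟩
      rw [hasFiniteIntegral_iff_enorm, lintegral_prod _ hmΘu.enorm]
      calc ∫⁻ t in Ioo 0 T, ∫⁻ y, ‖uncurry Θ (t, y)‖ₑ ≤ ∫⁻ _ in Ioo 0 T, (1 + (C : ℝ≥0∞)) := by
            refine lintegral_mono_ae ?_
            filter_upwards [hΘb] with t ht
            calc ∫⁻ y, ‖uncurry Θ (t, y)‖ₑ ≤ ∫⁻ y, (1 + ‖Θ t y‖ₑ ^ 2) :=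
                  lintegral_mono fun y => by
                    simpa using hmulsq 1 ‖Θ t y‖ₑ
              _ = 1 + ∫⁻ y, ‖Θ t y‖ₑ ^ 2 := by
                  rw [lintegral_add_left measurable_const, lintegral_const, measure_univ, mul_one]
              _ ≤ 1 + C := add_le_add le_rfl ht
        _ < ⊤ := by
            rw [setLIntegral_const]
            exact ENNReal.mul_lt_top (ENNReal.add_lt_top.2 ⟨ENNReal.one_lt_top, ENNReal.coe_lt_top⟩) hvol
    have hVΘ : Integrable (fun p : ℝ × UnitAddTorus (Fin 2) => ‖V p.1 p.2‖ * Θ p.1 p.2)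
        (((volume : Measure ℝ).restrict (Ioo 0 T)).prod volume) := by
      have hm : AEStronglyMeasurable (fun p : ℝ × UnitAddTorus (Fin 2) => ‖V p.1 p.2‖ * Θ p.1 p.2)
          (((volume : Measure ℝ).restrict (Ioo 0 T)).prod volume) := hmVu.norm.mul hmΘu
      refine ⟨hm, ?_⟩
      rw [hasFiniteIntegral_iff_enorm, lintegral_prod _ hm.enorm]
      simp only [enorm_mul, enorm_norm]
      exact hmul
    obtain ⟨C₁, hC₁⟩ := exists_bound_of_continuous_uncurry hφ.continuous_uncurry_timeDeriv 0 T
    obtain ⟨C₂, hC₂⟩ := exists_bound_of_continuous_uncurry hφ.continuous_uncurry_gradient 0 T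
    obtain ⟨C₃, hC₃⟩ := exists_bound_of_continuous_uncurry hφ.continuous_uncurry_laplacian 0 T
    have hAm : AEStronglyMeasurable (uncurry A) (((volume : Measure ℝ).restrict (Ioo 0 T)).prod volume) := by
      refine hmΘu.mul ((?_ : AEStronglyMeasurable _ _).add ?_ |>.add ?_)
      · exact hφ.continuous_uncurry_timeDeriv.aestronglyMeasurable
      · exact hmVu.inner hφ.continuous_uncurry_gradient.aestronglyMeasurable
      · exact (continuous_const.mul hφ.continuous_uncurry_laplacian).aestronglyMeasurable
    have hAi : Integrable (uncurry A) (((volume : Measure ℝ).restrict (Ioo 0 T)).prod volume) := by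
      refine Integrable.mono' (g := fun p : ℝ × UnitAddTorus (Fin 2) =>
          C₁ * ‖uncurry Θ p‖ + C₂ * ‖‖V p.1 p.2‖ * Θ p.1 p.2‖ + |ν| * C₃ * ‖uncurry Θ p‖)
        (((hΘ1.norm.const_mul C₁).add (hVΘ.norm.const_mul C₂)).add (hΘ1.norm.const_mul (|ν| * C₃))) hAm ?_
      filter_upwards [IsWeakScalarTransportForcedOn.ae_fst_mem_Ioo (d := Fin 2) T] with p hp
      have hp' : p.1 ∈ Icc 0 T := Ioo_subset_Icc_self hp
      simp only [uncurry, hA, Real.norm_eq_abs, abs_mul, abs_norm]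
      have h1 : |Torus.timeDeriv φ p.1 p.2| ≤ C₁ := by
        simpa [Real.norm_eq_abs] using hC₁ p.1 hp' p.2
      have h2 : |⟪V p.1 p.2, Torus.gradient (φ p.1) p.2⟫_ℝ| ≤ ‖V p.1 p.2‖ * C₂ :=
        (abs_real_inner_le_norm _ _).trans (mul_le_mul_of_nonneg_left (hC₂ p.1 hp' p.2) (norm_nonneg _))
      have h3 : |ν * Torus.laplacian (φ p.1) p.2| ≤ |ν| * C₃ := by
        rw [abs_mul]
        exact mul_le_mul_of_nonneg_left (by simpa [Real.norm_eq_abs] using hC₃ p.1 hp' p.2) (abs_nonneg _)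
      have hθ0 : 0 ≤ |Θ p.1 p.2| := abs_nonneg _
      calc |Θ p.1 p.2| * |Torus.timeDeriv φ p.1 p.2 +
            ⟪V p.1 p.2, Torus.gradient (φ p.1) p.2⟫_ℝ + ν * Torus.laplacian (φ p.1) p.2|
          ≤ |Θ p.1 p.2| * (C₁ + ‖V p.1 p.2‖ * C₂ + |ν| * C₃) := by
            refine mul_le_mul_of_nonneg_left ((abs_add_le _ _).trans (add_le_add ((abs_add_le _ _).trans
              (add_le_add h1 h2)) h3)) hθ0
        _ = C₁ * |Θ p.1 p.2| + C₂ * (‖V p.1 p.2‖ * |Θ p.1 p.2|) + |ν| * C₃ * |Θ p.1 p.2| := by ring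
    have hφc : Continuous (uncurry φ) := continuous_uncurry_of_continuous_stLift hφ.1.continuous
    obtain ⟨C₀, hC₀⟩ := exists_bound_of_continuous_uncurry hφc 0 T
    obtain ⟨Ch, hCh⟩ := exists_forall_norm_le_of_continuous hh.continuous
    have hBm : AEStronglyMeasurable (uncurry B) (((volume : Measure ℝ).restrict (Ioo 0 T)).prod volume) :=
      ((hh.continuous.comp continuous_snd).aestronglyMeasurable).mul hφc.aestronglyMeasurable
    haveI : IsFiniteMeasure (((volume : Measure ℝ).restrict (Ioo 0 T)).prod (volume : Measure (UnitAddTorus (Fin 2)))) := by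
      haveI : IsFiniteMeasure ((volume : Measure ℝ).restrict (Ioo 0 T)) := ⟨by rw [Measure.restrict_apply_univ]; exact hvol⟩
      infer_instance
    have hBi : Integrable (uncurry B) (((volume : Measure ℝ).restrict (Ioo 0 T)).prod volume) := by
      refine Integrable.mono' (g := fun _ => Ch * C₀) (integrable_const _) hBm ?_
      filter_upwards [IsWeakScalarTransportForcedOn.ae_fst_mem_Ioo (d := Fin 2) T] with p hp
      simp only [uncurry, hB, norm_mul]
      exact mul_le_mul (hCh p.2) (hC₀ p.1 (Ioo_subset_Icc_self hp) p.2) (norm_nonneg _) ((norm_nonneg _).trans (hCh p.2))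
    -- ### descent of the inner integrals, a.e. in time
    have hABm : ∀ᵐ t ∂(volume.restrict (Ioo 0 T)), AEStronglyMeasurable (fun y => A t y + B t y) volume := by
      filter_upwards [hAm.prodMk_left, hBm.prodMk_left] with t h1 h2
      exact h1.add h2
    have hinner : ∀ᵐ t ∂(volume.restrict (Ioo 0 T)),
        (∫ x, (⟪twoHalf (V t) (Θ t) x, Torus.timeDeriv (fun t => twoHalf 0 (φ t)) t x⟫_ℝ +
          ⟪twoHalf (V t) (Θ t) x, Torus.convect (twoHalf (V t) (Θ t)) (twoHalf 0 (φ t)) x⟫_ℝ +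
          ν * ⟪twoHalf (V t) (Θ t) x, Torus.laplacian (twoHalf 0 (φ t)) x⟫_ℝ + ⟪twoHalf g h x, twoHalf 0 (φ t) x⟫_ℝ)) =
        ∫ y, (A t y + B t y) := by
      filter_upwards [hABm] with t ht
      simp_rw [hpt t]
      exact integral_comp_planarProj (b := fun y => A t y + B t y) ht
    have hdatum : ∫ x, ⟪twoHalf a b x, twoHalf 0 (φ 0) x⟫_ℝ = ∫ y, b y * φ 0 y := by
      simp_rw [hpt0]
      exact integral_comp_planarProj (b := fun y => b y * φ 0 y) (hb.1.mul (hφ.isSmooth_slice 0).continuous.aestronglyMeasurable)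
    have hsplit : ∫ t in Ioo 0 T, ∫ y, (A t y + B t y) = (∫ t in Ioo 0 T, ∫ y, A t y) + ∫ t in Ioo 0 T, ∫ y, B t y :=
      integral_integral_add hAi hBi
    have key' : (∫ t in Ioo 0 T, ∫ y, (A t y + B t y)) + ∫ y, b y * φ 0 y = 0 := by
      rw [← integral_congr_ae hinner, ← hdatum]
      simpa only using key
    rw [hsplit] at key'
    simpa only [hA, hB] using key'

end ScalarDescent

end Summit.AnomalousDissipation.AnomalousDissipation.Theorems

end
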